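import Summits.FinalStateConjecture.FinalStateConjecture.Theses.NoParkingWithoutHorizon
import Literature.Geometry.Lorentzian.NormalisedNullRayCausal
import HarnessLib

/-!
# `NoParkingWithoutHorizon.ScriCompleteOfComplete` (stmt-FinalStateConjecture-10030) — proof

Stand-alone proof (imports only built modules) of the support item `ScriCompleteOfComplete` of the route
`NoParkingWithoutHorizon`; text = §19.A of the decomp-fsc lens-2 g19 kernel `ScriLift.lean` (its fileable twin
`dev/ScriCompleteOfComplete.lean`, sha256 9add5f535c92d1f9…, critic-verified decomp-fsc row 188), filed by a prover seat of
the same cell with the `#print axioms` line dropped, this docstring adapted, and the two ray lemmas of the twin replaced by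
their already-landed tree copies in `Literature.Geometry.Lorentzian.NormalisedNullRayCausal` (gate dedup); the closing
proof is otherwise verbatim.

Statement (the tree decl, BY NAME): for an admissible datum and a maximal vacuum Cauchy development that is future causally
geodesically complete (no future-incomplete future-directed null or timelike maximal geodesic, granted the Levi-Civita
connection), future null infinity is complete in Christodoulou's sojourn form
(`Summit.FinalStateConjecture.HasCompleteNullInfinity`).

Proof: a normalised future null ray from the data (`LorentzianMetric.IsNormalisedNullRayFrom`) is a maximal geodesic with
`0` in its affine domain whose velocity is null and future-directed throughout (propagation of the causal character along
geodesics, tree `IsNormalisedNullRayFrom.isNull_and_isFutureDirected_velocity_of_mem`, module `NormalisedNullRayCausal`); were its domain bounded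
above it would witness `IsFutureNullGeodesicallyIncomplete`; hence no ray has bounded domain, and the sojourn predicate holds
with empty compacta (tree `LorentzianMetric.hasCompleteFutureNullInfinity_of_forall_not_bddAbove`). Admissibility, maximality,
vacuum and the timelike half of the hypothesis are not used.

References: D. Christodoulou, *On the global initial value problem and the issue of singularities*, CQG 16 (1999) A23–A35,
pp. A26–A27 (sojourn form of complete `𝓘⁺`); S. W. Hawking, G. F. R. Ellis, *The large scale structure of space-time* (1973),
§8.1 pp. 256–258 (geodesic incompleteness); B. O'Neill, *Semi-Riemannian geometry* (1983), Ch. 5 Lemma 5.26, Ch. 14 p. 435.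
-/

-- D-0017: single-problem summit, `Summit.<S>.<S>.…` by design (cf. lakefile `weak.linter.dupNamespace`).
set_option linter.dupNamespace false

noncomputable section

open Literature.Geometry.Lorentzian
open LorentzianMetric
open scoped Manifold ContDiff Topology
open Set

namespace Summit.FinalStateConjecture.FinalStateConjecture.Theorems.NoParkingWithoutHorizonScriCompleteOfComplete


/- CITATION FORM (once the farm BUILDS the landed tree module
`Summits.FinalStateConjecture.FinalStateConjecture.Theorems.BondiDrainDispersalHorizonlessMustDrainScriCompleteOfFutureNullComplete`
— today `import` of it answers rc 75 `remote:stale:…:unbuilt`): the same item follows in one line from its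
`BondiDrainDispersalHorizonlessMustDrain.StubScriCompleteOfFutureNullComplete.hasCompleteFutureNullInfinity_of_not_isFutureNullGeodesicallyIncomplete`
(CauchyDevelopment generality; that file's docstring names stmt-10030 as "verbatim the mechanism"). The proof below is
self-contained over BUILT modules instead. -/

/-- **stmt-FinalStateConjecture-10030 by name.** [cite: Christodoulou1999, pp. A26–A27] [cite: HawkingEllis1973, §8.1] -/
theorem scriCompleteOfComplete : Theses.NoParkingWithoutHorizon.ScriCompleteOfComplete := by
  intro X _ _ _ _ _ _ D _ 𝒟 _ hc _
  exact hasCompleteFutureNullInfinity_of_forall_not_bddAbove fun p γ dom hγ hbdd ↦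
    hc.1 ⟨γ, dom, hγ.isMaximalGeodesicOn, ⟨0, hγ.zero_mem⟩, hbdd,
      fun _ ht ↦ hγ.isNull_and_isFutureDirected_velocity_of_mem ht⟩


end Summit.FinalStateConjecture.FinalStateConjecture.Theorems.NoParkingWithoutHorizonScriCompleteOfComplete

end
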